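import Literature.NumberTheory.ConnesMoscovici2022.UVProlateSpectrum
import HarnessLib

/-!
# Connes–Moscovici 2022, Definition of `W_sa`: the boundary conditions cut out a linear subspace

Topic `Literature/NumberTheory/ConnesMoscovici2022`; companion of `UVProlateSpectrum.lean`.  The named
fact `CM22_thm_1_6` ([ConnesMoscovici2022, Thm 1.6] = arXiv:2112.05500 Thm 2.6) opens with the clause
"the printed Definition of `W_sa` is well posed (some `W` with `IsProlateSA λ W` exists, i.e. the
boundary conditions cut out a linear subspace of `dom W_max`)".  This file PROVES that first clause:

* `prolateSADomain λ : Submodule ℂ L²(ℝ)` — the set `𝓛_β = prolateSASet λ` of [ConnesMoscovici2022,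
  Definition before Thm 1.6] (elements of `dom W_max` with a representative satisfying (1.19)–(1.21))
  IS a submodule: the boundary conditions are linear in the representative (sums/scalar multiples of
  representatives are representatives; derivatives add on the open set `ℝ ∖ {±λ}` and, for the
  conditions at `±∞`, beyond `|x| > λ`).
* `prolateSA λ := (prolateMax λ).domRestrict (prolateSADomain λ)` — "the restriction of `W_max` to
  `𝓛_β`" as a Mathlib `LinearPMap`, and `isProlateSA_prolateSA : IsProlateSA λ (prolateSA λ)`,
  `exists_isProlateSA : ∃ W, IsProlateSA λ W` (so the facts quantifying over `IsProlateSA λ W` —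
  `CM22_thm_1_6`, `CM22_cor_1_7`, `CM22_cor_2_2`, `CM22_thm_5_1` — are not vacuous).

Nothing is claimed here about self-adjointness (the remaining clauses of Thm 1.6).  RH-FREE corpus
literature; nothing here bears on the truth of RH.
-/

noncomputable section

open Complex Set MeasureTheory Filter Topology
open scoped Real Topology

namespace Literature.NumberTheory.ConnesMoscovici2022

variable {lam : ℝ}

/-! ## Linearity of the boundary conditions -/

section BC

/-- `S = ℝ ∖ {±λ}` is open (plumbing). [folklore] -/
private theorem isOpen_S (lam : ℝ) : IsOpen {x : ℝ | x ≠ lam ∧ x ≠ -lam} := isOpen_ne.and isOpen_ne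

/-- The zero function satisfies the boundary conditions. [cite: ConnesMoscovici2022, §1 Definition before Thm 1.6, eqs. (1.19)–(1.21) (= arXiv:2112.05500 (2.19)–(2.21), chunk p0006:L55–L69)] -/
theorem ProlateBC.zero (lam : ℝ) : ProlateBC lam (0 : ℝ → ℂ) := by
  have hd : ∀ x, deriv (0 : ℝ → ℂ) x = 0 := fun x => by
    rw [show (0 : ℝ → ℂ) = fun _ => (0 : ℂ) from rfl, deriv_const]
  have hE0 : evenFn (0 : ℝ → ℂ) = 0 := by funext y; simp [evenFn]
  have hO0 : oddFn (0 : ℝ → ℂ) = 0 := by funext y; simp [oddFn]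
  have hE : bcInfEven lam (evenFn (0 : ℝ → ℂ)) = fun _ => 0 := by
    funext x; rw [hE0, bcInfEven, hd]; simp
  have hO : bcInfOdd lam (oddFn (0 : ℝ → ℂ)) = fun _ => 0 := by
    funext x; rw [hO0, bcInfOdd, hd]; simp
  have hL : (fun x => pCoeff lam x * deriv (0 : ℝ → ℂ) x) = fun _ => 0 := by
    funext x; rw [hd, mul_zero]
  exact
    { differentiableOn := differentiableOn_const 0
      atLam := by rw [hL]; exact tendsto_const_nhds
      atNegLam := by rw [hL]; exact tendsto_const_nhds
      evenTop := by rw [hE]; exact tendsto_const_nhds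
      evenBot := by rw [hE]; exact tendsto_const_nhds
      oddTop := by rw [hO]; exact tendsto_const_nhds
      oddBot := by rw [hO]; exact tendsto_const_nhds }

/-- `evenFn` is additive. [folklore] -/
private theorem evenFn_add (g₁ g₂ : ℝ → ℂ) : evenFn (g₁ + g₂) = evenFn g₁ + evenFn g₂ := by
  funext x; simp [evenFn]; ring

/-- `oddFn` is additive. [folklore] -/
private theorem oddFn_add (g₁ g₂ : ℝ → ℂ) : oddFn (g₁ + g₂) = oddFn g₁ + oddFn g₂ := by
  funext x; simp [oddFn]; ring

/-- `evenFn` is homogeneous. [folklore] -/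
private theorem evenFn_smul (c : ℂ) (g : ℝ → ℂ) : evenFn (c • g) = c • evenFn g := by
  funext x; simp [evenFn]; ring

/-- `oddFn` is homogeneous. [folklore] -/
private theorem oddFn_smul (c : ℂ) (g : ℝ → ℂ) : oddFn (c • g) = c • oddFn g := by
  funext x; simp [oddFn]; ring

/-- Differentiability of `evenFn g` / `oddFn g` at `x` with `|x| > λ` from differentiability of `g` off
`±λ` (plumbing). [folklore] -/
private theorem differentiableAt_evenFn_oddFn (hlam : 0 < lam) {g : ℝ → ℂ}
    (hg : DifferentiableOn ℝ g {x | x ≠ lam ∧ x ≠ -lam}) {x : ℝ} (hx : lam < |x|) :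
    DifferentiableAt ℝ (evenFn g) x ∧ DifferentiableAt ℝ (oddFn g) x := by
  have hS := isOpen_S lam
  have hxS : x ∈ {x : ℝ | x ≠ lam ∧ x ≠ -lam} := by
    constructor
    · intro h; rw [h, abs_of_pos hlam] at hx; exact lt_irrefl _ hx
    · intro h; rw [h, abs_neg, abs_of_pos hlam] at hx; exact lt_irrefl _ hx
  have hnxS : -x ∈ {x : ℝ | x ≠ lam ∧ x ≠ -lam} := by
    constructor
    · intro h; rw [show x = -lam by linarith, abs_neg, abs_of_pos hlam] at hx; exact lt_irrefl _ hx
    · intro h; rw [show x = lam by linarith, abs_of_pos hlam] at hx; exact lt_irrefl _ hx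
  have h1 : DifferentiableAt ℝ g x := (hg x hxS).differentiableAt (hS.mem_nhds hxS)
  have h2 : DifferentiableAt ℝ (fun y => g (-y)) x := by
    have := (hg (-x) hnxS).differentiableAt (hS.mem_nhds hnxS)
    exact this.comp x differentiableAt_id.neg
  refine ⟨?_, ?_⟩
  · have : evenFn g = fun y => (g y + g (-y)) / 2 := rfl
    rw [this]; exact (h1.add h2).div_const 2
  · have : oddFn g = fun y => (g y - g (-y)) / 2 := rfl
    rw [this]; exact (h1.sub h2).div_const 2

/-- The boundary expressions are additive in `h` at points where both functions are differentiable.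
[folklore] -/
private theorem bcInfEven_add {h₁ h₂ : ℝ → ℂ} {x : ℝ} (h1 : DifferentiableAt ℝ h₁ x)
    (h2 : DifferentiableAt ℝ h₂ x) :
    bcInfEven lam (h₁ + h₂) x = bcInfEven lam h₁ x + bcInfEven lam h₂ x := by
  simp only [bcInfEven, Pi.add_apply, deriv_add h1 h2]; ring

/-- Additivity of the odd boundary expression (plumbing). [folklore] -/
private theorem bcInfOdd_add {h₁ h₂ : ℝ → ℂ} {x : ℝ} (h1 : DifferentiableAt ℝ h₁ x)
    (h2 : DifferentiableAt ℝ h₂ x) :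
    bcInfOdd lam (h₁ + h₂) x = bcInfOdd lam h₁ x + bcInfOdd lam h₂ x := by
  simp only [bcInfOdd, Pi.add_apply, deriv_add h1 h2]; ring

/-- Homogeneity of the even boundary expression (plumbing). [folklore] -/
private theorem bcInfEven_smul {h : ℝ → ℂ} (c : ℂ) {x : ℝ} (h1 : DifferentiableAt ℝ h x) :
    bcInfEven lam (c • h) x = c * bcInfEven lam h x := by
  have hd : deriv (c • h) x = c * deriv h x := by
    rw [show c • h = fun y => c * h y from rfl]; exact deriv_const_mul c h1
  simp only [bcInfEven, Pi.smul_apply, smul_eq_mul, hd]; ring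

/-- Homogeneity of the odd boundary expression (plumbing). [folklore] -/
private theorem bcInfOdd_smul {h : ℝ → ℂ} (c : ℂ) {x : ℝ} (h1 : DifferentiableAt ℝ h x) :
    bcInfOdd lam (c • h) x = c * bcInfOdd lam h x := by
  have hd : deriv (c • h) x = c * deriv h x := by
    rw [show c • h = fun y => c * h y from rfl]; exact deriv_const_mul c h1
  simp only [bcInfOdd, Pi.smul_apply, smul_eq_mul, hd]; ring

/-- **The boundary conditions (1.19)–(1.21) are stable under sums.** [cite: ConnesMoscovici2022, §1 Definition before Thm 1.6, eqs. (1.19)–(1.21) (= arXiv:2112.05500 (2.19)–(2.21), chunk p0006:L55–L69)] -/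
theorem ProlateBC.add (hlam : 0 < lam) {g₁ g₂ : ℝ → ℂ} (h₁ : ProlateBC lam g₁) (h₂ : ProlateBC lam g₂) :
    ProlateBC lam (g₁ + g₂) := by
  have hS := isOpen_S lam
  have hd₁ := h₁.differentiableOn
  have hd₂ := h₂.differentiableOn
  have hdAt : ∀ x ∈ {x : ℝ | x ≠ lam ∧ x ≠ -lam}, DifferentiableAt ℝ g₁ x ∧ DifferentiableAt ℝ g₂ x :=
    fun x hx => ⟨(hd₁ x hx).differentiableAt (hS.mem_nhds hx), (hd₂ x hx).differentiableAt (hS.mem_nhds hx)⟩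
  -- the condition at ±λ
  have hlam_cond : ∀ a : ℝ,
      Tendsto (fun x => pCoeff lam x * deriv g₁ x) (𝓝[{x | x ≠ lam ∧ x ≠ -lam}] a) (𝓝 0) →
      Tendsto (fun x => pCoeff lam x * deriv g₂ x) (𝓝[{x | x ≠ lam ∧ x ≠ -lam}] a) (𝓝 0) →
      Tendsto (fun x => pCoeff lam x * deriv (g₁ + g₂) x) (𝓝[{x | x ≠ lam ∧ x ≠ -lam}] a) (𝓝 0) := by
    intro a t₁ t₂
    have t := t₁.add t₂
    rw [add_zero] at t
    refine t.congr' ?_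
    filter_upwards [self_mem_nhdsWithin] with x hx
    rw [show (g₁ + g₂) = fun y => g₁ y + g₂ y from rfl, deriv_fun_add (hdAt x hx).1 (hdAt x hx).2]
    ring
  -- the conditions at ±∞
  have htop : ∀ᶠ x : ℝ in atTop, lam < |x| := by
    filter_upwards [eventually_gt_atTop lam] with x hx
    exact lt_of_lt_of_le hx (le_abs_self x)
  have hbot : ∀ᶠ x : ℝ in atBot, lam < |x| := by
    filter_upwards [eventually_lt_atBot (-lam)] with x hx
    rw [abs_of_neg (by linarith)]; linarith
  have heven : ∀ (l : Filter ℝ), (∀ᶠ x in l, lam < |x|) →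
      Tendsto (bcInfEven lam (evenFn g₁)) l (𝓝 0) → Tendsto (bcInfEven lam (evenFn g₂)) l (𝓝 0) →
      Tendsto (bcInfEven lam (evenFn (g₁ + g₂))) l (𝓝 0) := by
    intro l hl t₁ t₂
    have t := t₁.add t₂
    rw [add_zero] at t
    refine t.congr' ?_
    filter_upwards [hl] with x hx
    rw [evenFn_add, bcInfEven_add (differentiableAt_evenFn_oddFn hlam hd₁ hx).1
      (differentiableAt_evenFn_oddFn hlam hd₂ hx).1]
  have hodd : ∀ (l : Filter ℝ), (∀ᶠ x in l, lam < |x|) →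
      Tendsto (bcInfOdd lam (oddFn g₁)) l (𝓝 0) → Tendsto (bcInfOdd lam (oddFn g₂)) l (𝓝 0) →
      Tendsto (bcInfOdd lam (oddFn (g₁ + g₂))) l (𝓝 0) := by
    intro l hl t₁ t₂
    have t := t₁.add t₂
    rw [add_zero] at t
    refine t.congr' ?_
    filter_upwards [hl] with x hx
    rw [oddFn_add, bcInfOdd_add (differentiableAt_evenFn_oddFn hlam hd₁ hx).2
      (differentiableAt_evenFn_oddFn hlam hd₂ hx).2]
  exact
    { differentiableOn := hd₁.add hd₂
      atLam := hlam_cond lam h₁.atLam h₂.atLam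
      atNegLam := hlam_cond (-lam) h₁.atNegLam h₂.atNegLam
      evenTop := heven atTop htop h₁.evenTop h₂.evenTop
      evenBot := heven atBot hbot h₁.evenBot h₂.evenBot
      oddTop := hodd atTop htop h₁.oddTop h₂.oddTop
      oddBot := hodd atBot hbot h₁.oddBot h₂.oddBot }

/-- **The boundary conditions (1.19)–(1.21) are stable under scalar multiplication.** [cite: ConnesMoscovici2022, §1 Definition before Thm 1.6, eqs. (1.19)–(1.21) (= arXiv:2112.05500 (2.19)–(2.21), chunk p0006:L55–L69)] -/
theorem ProlateBC.smul (hlam : 0 < lam) (c : ℂ) {g : ℝ → ℂ} (h : ProlateBC lam g) :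
    ProlateBC lam (c • g) := by
  have hS := isOpen_S lam
  have hd := h.differentiableOn
  have hdAt : ∀ x ∈ {x : ℝ | x ≠ lam ∧ x ≠ -lam}, DifferentiableAt ℝ g x :=
    fun x hx => (hd x hx).differentiableAt (hS.mem_nhds hx)
  have hlam_cond : ∀ a : ℝ,
      Tendsto (fun x => pCoeff lam x * deriv g x) (𝓝[{x | x ≠ lam ∧ x ≠ -lam}] a) (𝓝 0) →
      Tendsto (fun x => pCoeff lam x * deriv (c • g) x) (𝓝[{x | x ≠ lam ∧ x ≠ -lam}] a) (𝓝 0) := by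
    intro a t
    have t' := t.const_mul c
    rw [mul_zero] at t'
    refine t'.congr' ?_
    filter_upwards [self_mem_nhdsWithin] with x hx
    rw [show (c • g) = fun y => c * g y from rfl, deriv_const_mul c (hdAt x hx)]
    ring
  have htop : ∀ᶠ x : ℝ in atTop, lam < |x| := by
    filter_upwards [eventually_gt_atTop lam] with x hx
    exact lt_of_lt_of_le hx (le_abs_self x)
  have hbot : ∀ᶠ x : ℝ in atBot, lam < |x| := by
    filter_upwards [eventually_lt_atBot (-lam)] with x hx
    rw [abs_of_neg (by linarith)]; linarith
  have heven : ∀ (l : Filter ℝ), (∀ᶠ x in l, lam < |x|) →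
      Tendsto (bcInfEven lam (evenFn g)) l (𝓝 0) → Tendsto (bcInfEven lam (evenFn (c • g))) l (𝓝 0) := by
    intro l hl t
    have t' := t.const_mul c
    rw [mul_zero] at t'
    refine t'.congr' ?_
    filter_upwards [hl] with x hx
    rw [evenFn_smul, bcInfEven_smul c (differentiableAt_evenFn_oddFn hlam hd hx).1]
  have hodd : ∀ (l : Filter ℝ), (∀ᶠ x in l, lam < |x|) →
      Tendsto (bcInfOdd lam (oddFn g)) l (𝓝 0) → Tendsto (bcInfOdd lam (oddFn (c • g))) l (𝓝 0) := by
    intro l hl t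
    have t' := t.const_mul c
    rw [mul_zero] at t'
    refine t'.congr' ?_
    filter_upwards [hl] with x hx
    rw [oddFn_smul, bcInfOdd_smul c (differentiableAt_evenFn_oddFn hlam hd hx).2]
  exact
    { differentiableOn := hd.const_smul c
      atLam := hlam_cond lam h.atLam
      atNegLam := hlam_cond (-lam) h.atNegLam
      evenTop := heven atTop htop h.evenTop
      evenBot := heven atBot hbot h.evenBot
      oddTop := hodd atTop htop h.oddTop
      oddBot := hodd atBot hbot h.oddBot }

end BC

/-! ## `𝓛_β` as a submodule and `W_sa` as a `LinearPMap` -/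

/-- **`𝓛_β = dom W_sa` as a submodule of `L²(ℝ)`**: the carrier is exactly `prolateSASet λ`.
[cite: ConnesMoscovici2022, §1 Definition before Thm 1.6 (= arXiv:2112.05500 chunk p0006:L52–L69)] -/
def prolateSADomain (lam : ℝ) (hlam : 0 < lam) : Submodule ℂ L2R where
  carrier := prolateSASet lam
  zero_mem' := ⟨Submodule.zero_mem _, 0, Lp.coeFn_zero _ _ _, ProlateBC.zero lam⟩
  add_mem' := by
    rintro ξ η ⟨hξ, g₁, hg₁, hb₁⟩ ⟨hη, g₂, hg₂, hb₂⟩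
    refine ⟨Submodule.add_mem _ hξ hη, g₁ + g₂, ?_, hb₁.add hlam hb₂⟩
    filter_upwards [Lp.coeFn_add ξ η, hg₁, hg₂] with x hx h1 h2
    rw [hx, Pi.add_apply, Pi.add_apply, h1, h2]
  smul_mem' := by
    rintro c ξ ⟨hξ, g, hg, hb⟩
    refine ⟨Submodule.smul_mem _ c hξ, c • g, ?_, hb.smul hlam c⟩
    filter_upwards [Lp.coeFn_smul c ξ, hg] with x hx h1
    rw [hx, Pi.smul_apply, Pi.smul_apply, h1]

/-- The carrier of `prolateSADomain` is `prolateSASet`. [cite: ConnesMoscovici2022, §1 Definition before Thm 1.6 (= arXiv:2112.05500 chunk p0006:L52–L69)] -/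
@[simp] theorem mem_prolateSADomain (hlam : 0 < lam) (ξ : L2R) :
    ξ ∈ prolateSADomain lam hlam ↔ ξ ∈ prolateSASet lam := Iff.rfl

/-- `𝓛_β ⊆ dom W_max`. [cite: ConnesMoscovici2022, §1 Definition before Thm 1.6 (= arXiv:2112.05500 chunk p0006:L52–L55)] -/
theorem prolateSADomain_le (hlam : 0 < lam) : prolateSADomain lam hlam ≤ (prolateMax lam).domain :=
  fun _ hξ => hξ.1

/-- **`W_sa`**: "the restriction of the operator `W_max` to the subspace `𝓛_β`" (Mathlib
`LinearPMap.domRestrict`). [cite: ConnesMoscovici2022, §1 Definition before Thm 1.6 (= arXiv:2112.05500 chunk p0006:L52–L55)] -/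
def prolateSA (lam : ℝ) (hlam : 0 < lam) : L2R →ₗ.[ℂ] L2R :=
  (prolateMax lam).domRestrict (prolateSADomain lam hlam)

/-- The domain of `W_sa` is `𝓛_β`. [cite: ConnesMoscovici2022, §1 Definition before Thm 1.6 (= arXiv:2112.05500 chunk p0006:L52–L55)] -/
theorem prolateSA_domain (hlam : 0 < lam) : (prolateSA lam hlam).domain = prolateSADomain lam hlam := by
  rw [prolateSA, LinearPMap.domRestrict_domain]
  exact inf_eq_left.2 (prolateSADomain_le hlam)

/-- **`W_sa` is well defined**: `IsProlateSA λ (prolateSA λ)`. [cite: ConnesMoscovici2022, §1 Definition before Thm 1.6 (= arXiv:2112.05500 chunk p0006:L52–L69)] -/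
theorem isProlateSA_prolateSA (hlam : 0 < lam) : IsProlateSA lam (prolateSA lam hlam) := by
  refine ⟨LinearPMap.domRestrict_le, ?_⟩
  rw [prolateSA_domain hlam]
  rfl

/-- **First clause of [ConnesMoscovici2022, Thm 1.6] as typed (`CM22_thm_1_6`)**: the boundary
conditions cut out a linear subspace, so some `W` with `IsProlateSA λ W` exists.
[cite: ConnesMoscovici2022, Thm 1.6 (= arXiv:2112.05500 Thm 2.6, chunk p0006:L76–L79)] -/
theorem exists_isProlateSA (lam : ℝ) (hlam : 0 < lam) : ∃ W : L2R →ₗ.[ℂ] L2R, IsProlateSA lam W :=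
  ⟨prolateSA lam hlam, isProlateSA_prolateSA hlam⟩

/-- **Uniqueness of `W_sa` as a partially defined operator**: any `W` with `IsProlateSA λ W` IS
`prolateSA λ` (both are restrictions of `W_max` to the same domain), so the facts typed with
`∀ W, IsProlateSA λ W → …` speak about one operator.
[cite: ConnesMoscovici2022, §1 Definition before Thm 1.6 (= arXiv:2112.05500 chunk p0006:L52–L55)] -/
theorem IsProlateSA.eq_prolateSA (hlam : 0 < lam) {W : L2R →ₗ.[ℂ] L2R} (h : IsProlateSA lam W) :
    W = prolateSA lam hlam := by
  obtain ⟨hle, hdom⟩ := h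
  have hdom' : W.domain = (prolateSA lam hlam).domain := by
    rw [prolateSA_domain hlam]
    exact SetLike.coe_injective (by rw [hdom]; rfl)
  refine LinearPMap.eq_of_le_of_domain_eq ?_ hdom'
  refine ⟨hdom'.le, fun x y hxy => ?_⟩
  have h1 : W x = prolateMax lam ⟨x, hle.1 x.2⟩ := hle.2 rfl
  have hle' : prolateSA lam hlam ≤ prolateMax lam := (isProlateSA_prolateSA hlam).1
  have h2 : prolateSA lam hlam y = prolateMax lam ⟨y, hle'.1 y.2⟩ := hle'.2 rfl
  rw [h1, h2]
  congr 1
  exact Subtype.ext hxy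

/-- `IsProlateSA λ W ↔ W = prolateSA λ`. [cite: ConnesMoscovici2022, §1 Definition before Thm 1.6 (= arXiv:2112.05500 chunk p0006:L52–L55)] -/
theorem isProlateSA_iff (hlam : 0 < lam) {W : L2R →ₗ.[ℂ] L2R} :
    IsProlateSA lam W ↔ W = prolateSA lam hlam :=
  ⟨fun h => h.eq_prolateSA hlam, fun h => h ▸ isProlateSA_prolateSA hlam⟩

end Literature.NumberTheory.ConnesMoscovici2022
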